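import Summits.CriticalPhenomena.SAWScalingLimit.Theorems.SAWTotalPositivityBoundaryTP2Strip3Facing
import HarnessLib

/-!
# Crux `BoundaryTP2` (stmt-CriticalPhenomena-7115), line `Sketch`: the crux AS TYPED on every 3-row strip
for every two-left/two-right quadruple (lead c6 assembly, part 2)

From the six real kernel inequalities of `strip3_kernel_ineqs` (part 1) and the reflection symmetries of
the box kernels, the eighteen TP₂ inequalities of the facing family on the strip
`rectDomain L 2 = {0..L} × {0,1,2}` follow for every `L ≥ 1` and every `x ∈ [1/3, 5/13]`
(`strip3_facing_tp2`): for rows `j₂ < j₁` on the left column and `j₃ < j₄` on the right column, with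
`p₁ = (0,j₁)`, `p₂ = (0,j₂)`, `p₃ = (L,j₃)`, `p₄ = (L,j₄)`,
`Z(p₁,p₃)Z(p₂,p₄) ≤ Z(p₁,p₂)Z(p₃,p₄)` (end pairs) and `Z(p₁,p₃)Z(p₂,p₄) ≤ Z(p₁,p₄)Z(p₂,p₃)` (facing minor).
With `1/3 ≤ x_c` (unconditional, `μ ≤ 3`) and `x_c ≤ 5/13` — taken as a hypothesis `hxc`: it is
`2.6 ≤ μ`, available unconditionally but through `native_decide` (`SAW.le_connectiveConstant_26`, strip
transfer-matrix count) and axiom-free from the quoted bounds `SAW.LawlerSchrammWerner2004SAW_connectiveConstant_bounds`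
(`criticalFugacity_le_five_thirteenths_of_LSW`) — the crux `BoundaryTP2` holds AS TYPED — hypotheses (from
`stub_rect_facingPairs`) and conclusion — for both labellings of every such quadruple of every 3-row strip
(`boundaryTP2_strip3_facing`, `boundaryTP2_strip3_facing'`): after the ladders (c5), the second infinite
family of domains, and the first with an entangled cut.
-/

noncomputable section

namespace Summit.CriticalPhenomena.SAWScalingLimit.Theorems.BoundaryTP2

open Literature.Probability.LatticeModels Literature.Probability.RandomPlanarGeometry
open Summit.CriticalPhenomena.SAWScalingLimit.Theorems.EdgeOfPositivity.Negative
open scoped ENNReal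

/-- A product inequality of strip kernels from its real form. [folklore] -/
private theorem s3t_mul_le (L : ℕ) (x : ℝ) {a b c d a' b' c' d' : Site 2}
    (h : (pathKernel (discreteDomainGraph (rectDomain L 2) 1) x a b).toReal *
        (pathKernel (discreteDomainGraph (rectDomain L 2) 1) x c d).toReal ≤
      (pathKernel (discreteDomainGraph (rectDomain L 2) 1) x a' b').toReal *
        (pathKernel (discreteDomainGraph (rectDomain L 2) 1) x c' d').toReal) :
    pathKernel (discreteDomainGraph (rectDomain L 2) 1) x a b *
        pathKernel (discreteDomainGraph (rectDomain L 2) 1) x c d ≤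
      pathKernel (discreteDomainGraph (rectDomain L 2) 1) x a' b' *
        pathKernel (discreteDomainGraph (rectDomain L 2) 1) x c' d' := by
  rw [← ENNReal.toReal_le_toReal (ENNReal.mul_ne_top (strip3_ne_top L x a b) (strip3_ne_top L x c d))
    (ENNReal.mul_ne_top (strip3_ne_top L x a' b') (strip3_ne_top L x c' d')), ENNReal.toReal_mul,
    ENNReal.toReal_mul]
  exact h

/-- **The facing family on every 3-row strip (graph level).** For `L ≥ 1`, `x ∈ [1/3, 5/13]`, rows
`0 ≤ j₂ < j₁ ≤ 2` on the left column and `0 ≤ j₃ < j₄ ≤ 2` on the right column of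
`rectDomain L 2`: both TP₂ inequalities for `p₁ = (0,j₁)`, `p₂ = (0,j₂)`, `p₃ = (L,j₃)`, `p₄ = (L,j₄)`.
The nine row patterns reduce by the reflections `i ↦ L-i`, `j ↦ 2-j` and reversal to the six real
inequalities `c ≤ a`, `b² ≤ ae`, `ce ≤ b²`, `c ≤ E`, `b ≤ K'`, `ce ≤ K'²` of `strip3_kernel_ineqs`. [folklore] -/
theorem strip3_facing_tp2 (L : ℕ) (hL : 1 ≤ L) {x : ℝ} (hx1 : 1 / 3 ≤ x) (hx2 : x ≤ 5 / 13)
    {j₁ j₂ j₃ j₄ : ℤ} (h₂ : 0 ≤ j₂) (h₂₁ : j₂ < j₁) (h₁ : j₁ ≤ 2) (h₃ : 0 ≤ j₃) (h₃₄ : j₃ < j₄)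
    (h₄ : j₄ ≤ 2) :
    pathKernel (discreteDomainGraph (rectDomain L 2) 1) x (st 0 j₁) (st L j₃) *
          pathKernel (discreteDomainGraph (rectDomain L 2) 1) x (st 0 j₂) (st L j₄) ≤
        pathKernel (discreteDomainGraph (rectDomain L 2) 1) x (st 0 j₁) (st 0 j₂) *
          pathKernel (discreteDomainGraph (rectDomain L 2) 1) x (st L j₃) (st L j₄) ∧
      pathKernel (discreteDomainGraph (rectDomain L 2) 1) x (st 0 j₁) (st L j₃) *
          pathKernel (discreteDomainGraph (rectDomain L 2) 1) x (st 0 j₂) (st L j₄) ≤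
        pathKernel (discreteDomainGraph (rectDomain L 2) 1) x (st 0 j₁) (st L j₄) *
          pathKernel (discreteDomainGraph (rectDomain L 2) 1) x (st 0 j₂) (st L j₃) := by
  set R := discreteDomainGraph (rectDomain L 2) 1 with hR
  obtain ⟨hA, hM1, hM2, hB, hE1, hE2⟩ := strip3_kernel_ineqs L hL hx1 hx2
  -- the six letters
  set a := (pathKernel R x (st 0 0) (st L 0)).toReal with ha
  set b := (pathKernel R x (st 0 0) (st L 1)).toReal with hb
  set c := (pathKernel R x (st 0 0) (st L 2)).toReal with hc
  set e := (pathKernel R x (st 0 1) (st L 1)).toReal with he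
  set E := (pathKernel R x (st 0 0) (st 0 2)).toReal with hE
  set K' := (pathKernel R x (st 0 0) (st 0 1)).toReal with hK'
  have a0 : 0 ≤ a := ENNReal.toReal_nonneg
  have b0 : 0 ≤ b := ENNReal.toReal_nonneg
  have c0 : 0 ≤ c := ENNReal.toReal_nonneg
  have e0 : 0 ≤ e := ENNReal.toReal_nonneg
  have E0 : 0 ≤ E := ENNReal.toReal_nonneg
  have K0 : 0 ≤ K' := ENNReal.toReal_nonneg
  -- reflection dictionary (kernel level)
  have r1 : pathKernel R x (st 0 1) (st L 0) = pathKernel R x (st 0 0) (st L 1) := by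
    have h := (stub_rect_reflect L 2 x 0 1 L 0).1
    norm_num at h; rw [hR, h, pathKernel_comm]
  have r2 : pathKernel R x (st 0 1) (st L 2) = pathKernel R x (st 0 0) (st L 1) := by
    have h := (stub_rect_reflect L 2 x 0 1 L 2).2
    norm_num at h; rw [hR, h, ← hR, r1]
  have r3 : pathKernel R x (st 0 2) (st L 1) = pathKernel R x (st 0 0) (st L 1) := by
    have h := (stub_rect_reflect L 2 x 0 2 L 1).2
    norm_num at h; rw [hR, h]
  have r4 : pathKernel R x (st 0 2) (st L 2) = pathKernel R x (st 0 0) (st L 0) := by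
    have h := (stub_rect_reflect L 2 x 0 2 L 2).2
    norm_num at h; rw [hR, h]
  have r5 : pathKernel R x (st 0 2) (st L 0) = pathKernel R x (st 0 0) (st L 2) := by
    have h := (stub_rect_reflect L 2 x 0 2 L 0).2
    norm_num at h; rw [hR, h]
  have l1 : pathKernel R x (st 0 1) (st 0 0) = pathKernel R x (st 0 0) (st 0 1) := pathKernel_comm _ _ _ _
  have l2 : pathKernel R x (st 0 2) (st 0 0) = pathKernel R x (st 0 0) (st 0 2) := pathKernel_comm _ _ _ _
  have l3 : pathKernel R x (st 0 2) (st 0 1) = pathKernel R x (st 0 0) (st 0 1) := by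
    have h := (stub_rect_reflect L 2 x 0 2 0 1).2
    norm_num at h; rw [hR, h]
  have e1 : pathKernel R x (st L 0) (st L 1) = pathKernel R x (st 0 0) (st 0 1) := by
    have h := (stub_rect_reflect L 2 x L 0 L 1).1
    norm_num at h; rw [hR, h]
  have e2 : pathKernel R x (st L 0) (st L 2) = pathKernel R x (st 0 0) (st 0 2) := by
    have h := (stub_rect_reflect L 2 x L 0 L 2).1
    norm_num at h; rw [hR, h]
  have e3 : pathKernel R x (st L 1) (st L 2) = pathKernel R x (st 0 0) (st 0 1) := by
    have h := (stub_rect_reflect L 2 x L 1 L 2).1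
    have h' := (stub_rect_reflect L 2 x 0 1 0 2).2
    norm_num at h h'; rw [hR, h, h', pathKernel_comm]
  -- the nine row patterns
  obtain ⟨rfl, rfl⟩ | ⟨rfl, rfl⟩ | ⟨rfl, rfl⟩ :
      (j₂ = 0 ∧ j₁ = 1) ∨ (j₂ = 0 ∧ j₁ = 2) ∨ (j₂ = 1 ∧ j₁ = 2) := by omega
  all_goals
    obtain ⟨rfl, rfl⟩ | ⟨rfl, rfl⟩ | ⟨rfl, rfl⟩ :
        (j₃ = 0 ∧ j₄ = 1) ∨ (j₃ = 0 ∧ j₄ = 2) ∨ (j₃ = 1 ∧ j₄ = 2) := by omega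
  -- (j₂,j₁,j₃,j₄) = (0,1,0,1)
  · rw [r1, l1, e1]
    exact ⟨s3t_mul_le L x (by rw [← hb, ← hK']; exact mul_le_mul hE1 hE1 b0 K0),
      s3t_mul_le L x (by rw [← hb, ← he, ← ha]; nlinarith [hM1])⟩
  -- (0,1,0,2)
  · rw [r1, r2, l1, e2]
    exact ⟨s3t_mul_le L x (by rw [← hb, ← hc, ← hK', ← hE]; exact mul_le_mul hE1 hB c0 K0),
      s3t_mul_le L x (by rw [← hb, ← hc, ← ha]; exact mul_le_mul_of_nonneg_left hA b0)⟩
  -- (0,1,1,2)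
  · rw [r2, l1, e3]
    refine ⟨s3t_mul_le L x (by rw [← he, ← hc, ← hK']; nlinarith [hE2]),
      s3t_mul_le L x (by rw [← he, ← hc, ← hb]; nlinarith [hM2])⟩
  -- (0,2,0,1)
  · rw [r5, r3, l2, e1]
    exact ⟨s3t_mul_le L x (by rw [← hc, ← hb, ← hE, ← hK']; exact mul_le_mul hB hE1 b0 E0),
      s3t_mul_le L x (by rw [← hc, ← hb, ← ha]; nlinarith [hA, b0])⟩
  -- (0,2,0,2)
  · rw [r5, r4, l2, e2]
    exact ⟨s3t_mul_le L x (by rw [← hc, ← hE]; exact mul_le_mul hB hB c0 E0),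
      s3t_mul_le L x (by rw [← hc, ← ha]; exact mul_le_mul hA hA c0 a0)⟩
  -- (0,2,1,2)
  · rw [r3, r4, l2, e3]
    exact ⟨s3t_mul_le L x (by rw [← hb, ← hc, ← hE, ← hK']; nlinarith [mul_le_mul hB hE1 b0 E0]),
      s3t_mul_le L x (by rw [← hb, ← hc, ← ha]; nlinarith [mul_le_mul_of_nonneg_left hA b0])⟩
  -- (1,2,0,1)
  · rw [r5, r3, r1, l3, e1]
    exact ⟨s3t_mul_le L x (by rw [← hc, ← he, ← hK']; nlinarith [hE2]),
      s3t_mul_le L x (by rw [← hc, ← he, ← hb]; nlinarith [hM2])⟩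
  -- (1,2,0,2)
  · rw [r5, r2, r4, r1, l3, e2]
    exact ⟨s3t_mul_le L x (by rw [← hc, ← hb, ← hK', ← hE]; nlinarith [mul_le_mul hB hE1 b0 E0]),
      s3t_mul_le L x (by rw [← hc, ← hb, ← ha]; nlinarith [mul_le_mul_of_nonneg_left hA b0])⟩
  -- (1,2,1,2)
  · rw [r3, r2, r4, l3, e3]
    exact ⟨s3t_mul_le L x (by rw [← hb, ← hK']; exact mul_le_mul hE1 hE1 b0 K0),
      s3t_mul_le L x (by rw [← hb, ← ha, ← he]; nlinarith [hM1])⟩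

/-- `x_c ≤ 5/13` from the quoted bounds `2.6 ≤ μ ≤ 2.7` (axiom-free discharge of the hypothesis `hxc` below;
the unconditional discharge is `SAW.le_connectiveConstant_26`, which goes through `native_decide`). [folklore] -/
theorem criticalFugacity_le_five_thirteenths_of_LSW (hμ : SAW.LawlerSchrammWerner2004SAW_connectiveConstant_bounds) :
    SAW.criticalFugacity ≤ 5 / 13 := by
  have h26 := hμ.1
  rw [SAW.criticalFugacity, inv_le_comm₀ (by linarith) (by norm_num)]
  norm_num
  linarith

/-- **The crux `BoundaryTP2` AS TYPED on every 3-row strip, facing quadruples, first labelling.**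
For `Ω = rectDomain L 2` (`L ≥ 1`), `δ = 1`, rows `0 ≤ j₂ < j₁ ≤ 2`, `0 ≤ j₃ < j₄ ≤ 2` and
`p₁ = (0,j₁)`, `p₂ = (0,j₂)`, `p₃ = (L,j₃)`, `p₄ = (L,j₄)`: the three hypotheses of the crux hold as typed
(interlacing; `(p₁p₂|p₃p₄)` and `(p₁p₄|p₂p₃)` disjointly realisable) AND its conclusion
`Z(p₁,p₃)Z(p₂,p₄) ≤ Z(p₁,p₂)Z(p₃,p₄)` holds at `x_c` (given `x_c ≤ 5/13`, see `criticalFugacity_le_five_thirteenths_of_LSW`). [folklore] -/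
theorem boundaryTP2_strip3_facing (hxc : SAW.criticalFugacity ≤ 5 / 13) (L : ℕ) (hL : 1 ≤ L) {j₁ j₂ j₃ j₄ : ℤ}
    (h₂ : 0 ≤ j₂) (h₂₁ : j₂ < j₁) (h₁ : j₁ ≤ 2) (h₃ : 0 ≤ j₃) (h₃₄ : j₃ < j₄) (h₄ : j₄ ≤ 2) :
    (∀ (P : SAW.DomainSAW (rectDomain L 2) 1 (st 0 j₁) (st L j₃))
        (Q : SAW.DomainSAW (rectDomain L 2) 1 (st 0 j₂) (st L j₄)),
        ∃ v, v ∈ P.walk.support ∧ v ∈ Q.walk.support) ∧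
    (∃ (P : SAW.DomainSAW (rectDomain L 2) 1 (st 0 j₁) (st 0 j₂))
        (Q : SAW.DomainSAW (rectDomain L 2) 1 (st L j₃) (st L j₄)),
        List.Disjoint P.walk.support Q.walk.support) ∧
    (∃ (P : SAW.DomainSAW (rectDomain L 2) 1 (st 0 j₁) (st L j₄))
        (Q : SAW.DomainSAW (rectDomain L 2) 1 (st 0 j₂) (st L j₃)),
        List.Disjoint P.walk.support Q.walk.support) ∧
    SAW.weight (rectDomain L 2) 1 (st 0 j₁) (st L j₃) Set.univ *
        SAW.weight (rectDomain L 2) 1 (st 0 j₂) (st L j₄) Set.univ ≤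
      SAW.weight (rectDomain L 2) 1 (st 0 j₁) (st 0 j₂) Set.univ *
        SAW.weight (rectDomain L 2) 1 (st L j₃) (st L j₄) Set.univ := by
  obtain ⟨hI, hD₁, hD₂⟩ := stub_rect_facingPairs L 2 hL h₂ h₂₁ h₁ h₃ h₃₄ h₄
  refine ⟨fun P Q => hI ⟨P.walk, P.isPath⟩ ⟨Q.walk, Q.isPath⟩, ?_, ?_, ?_⟩
  · obtain ⟨P, Q, hPQ⟩ := hD₁
    exact ⟨⟨P.1, P.2⟩, ⟨Q.1, Q.2⟩, by simpa using hPQ⟩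
  · obtain ⟨P, Q, hPQ⟩ := hD₂
    exact ⟨⟨P.1, P.2⟩, ⟨Q.1, Q.2⟩, by simpa using hPQ⟩
  · simp only [weight_univ_eq_pathKernel]
    exact (strip3_facing_tp2 L hL SAW.one_third_le_criticalFugacity hxc
      h₂ h₂₁ h₁ h₃ h₃₄ h₄).1

/-- **The crux `BoundaryTP2` AS TYPED on every 3-row strip, facing quadruples, second labelling**
(`p₂ ↔ p₄`): for `p₁ = (0,j₁)`, `p₂ = (L,j₄)`, `p₃ = (L,j₃)`, `p₄ = (0,j₂)` the hypotheses hold as typed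
and the conclusion is the facing minor `Z(p₁,p₃)Z(p₂,p₄) ≤ Z(p₁,p₂)Z(p₃,p₄)`, i.e.
`Z((0,j₁),(L,j₃)) Z((L,j₄),(0,j₂)) ≤ Z((0,j₁),(L,j₄)) Z((L,j₃),(0,j₂))`, at `x_c`. [folklore] -/
theorem boundaryTP2_strip3_facing' (hxc : SAW.criticalFugacity ≤ 5 / 13) (L : ℕ) (hL : 1 ≤ L) {j₁ j₂ j₃ j₄ : ℤ}
    (h₂ : 0 ≤ j₂) (h₂₁ : j₂ < j₁) (h₁ : j₁ ≤ 2) (h₃ : 0 ≤ j₃) (h₃₄ : j₃ < j₄) (h₄ : j₄ ≤ 2) :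
    (∀ (P : SAW.DomainSAW (rectDomain L 2) 1 (st 0 j₁) (st L j₃))
        (Q : SAW.DomainSAW (rectDomain L 2) 1 (st L j₄) (st 0 j₂)),
        ∃ v, v ∈ P.walk.support ∧ v ∈ Q.walk.support) ∧
    (∃ (P : SAW.DomainSAW (rectDomain L 2) 1 (st 0 j₁) (st L j₄))
        (Q : SAW.DomainSAW (rectDomain L 2) 1 (st L j₃) (st 0 j₂)),
        List.Disjoint P.walk.support Q.walk.support) ∧
    (∃ (P : SAW.DomainSAW (rectDomain L 2) 1 (st 0 j₁) (st 0 j₂))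
        (Q : SAW.DomainSAW (rectDomain L 2) 1 (st L j₄) (st L j₃)),
        List.Disjoint P.walk.support Q.walk.support) ∧
    SAW.weight (rectDomain L 2) 1 (st 0 j₁) (st L j₃) Set.univ *
        SAW.weight (rectDomain L 2) 1 (st L j₄) (st 0 j₂) Set.univ ≤
      SAW.weight (rectDomain L 2) 1 (st 0 j₁) (st L j₄) Set.univ *
        SAW.weight (rectDomain L 2) 1 (st L j₃) (st 0 j₂) Set.univ := by
  obtain ⟨hI, hD₁, hD₂⟩ := stub_rect_facingPairs L 2 hL h₂ h₂₁ h₁ h₃ h₃₄ h₄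
  have hI' := hI.reverse_right
  have hD₁' := hD₂.reverse_right
  have hD₂' := hD₁.reverse_right
  refine ⟨fun P Q => hI' ⟨P.walk, P.isPath⟩ ⟨Q.walk, Q.isPath⟩, ?_, ?_, ?_⟩
  · obtain ⟨P, Q, hPQ⟩ := hD₁'
    exact ⟨⟨P.1, P.2⟩, ⟨Q.1, Q.2⟩, by simpa using hPQ⟩
  · obtain ⟨P, Q, hPQ⟩ := hD₂'
    exact ⟨⟨P.1, P.2⟩, ⟨Q.1, Q.2⟩, by simpa using hPQ⟩
  · simp only [weight_univ_eq_pathKernel]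
    have h := (strip3_facing_tp2 L hL SAW.one_third_le_criticalFugacity hxc
      h₂ h₂₁ h₁ h₃ h₃₄ h₄).2
    rw [pathKernel_comm _ _ (st L j₄) (st 0 j₂), pathKernel_comm _ _ (st L j₃) (st 0 j₂)]
    exact h

end Summit.CriticalPhenomena.SAWScalingLimit.Theorems.BoundaryTP2
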